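import Mathlib
import Summits.Ventures.HodgeRepro.Tier4.Line4.ArchWitnessLeftLaw
import Summits.Ventures.HodgeRepro.Tier4.Line4.ArchFactorMismatch
import Summits.Ventures.HodgeRepro.Tier4.Line4.TorusMeasurableMul
import Summits.Ventures.HodgeRepro.Tier4.Line4.TorusWeightLocal

/-!
# Tier4/Line4/ArchFourierTorus — C-L4-HF-TORUS, part 2: the `hF` conjunct of the `γ₀`-existence display read as a
FUNCTION of `γ₀` — its `(T_∞, T′(𝔸))`-equivariance and the IDENTITY-INSTANCE REDUCTION (`T ≤ T′`):
`hF(γ₀) ⟺ (χ = Wt⁻¹ on T_∞) ∧ archWitnessOf γ₀ ≠ 0`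

Blind re-derivation cell `pub-hodge-repro`, Tier 4 «prove the step» (README §9–§10), seat t4-L4-x2 (extra prover, LINE L4,
gen 2; the `harch ≠ 0` half of the lead's S15082 (i); self-named cut S16292).  Target tree path
`lean/Summits/Ventures/HodgeRepro/Tier4/Line4/ArchFourierTorus.lean`.  On part 1 (Tier4/Line4/ArchWitnessLeftLaw: the
left / right `T′(𝔸)`-laws of `archWitnessOf` and the pointwise criterion), ArchFactorMismatch (p698589: character
orthogonality `integral_eq_zero_of_mul_left_eq_smul`), TorusWeightLocal (p706805: `torusWeight'_mul`), L4-p1's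
TorusMeasurableMul (p714979: `measurableMul_torusInf`); no printed input.

THE OBJECT.  The (7a) support lemma `d3CoeffData'_seesaw` (ArchMatchingSeesaw p709235) and the `γ₀`-existence display of
record (skeleton v0.45 L1887–L1890) carry the archimedean conjunct
`hF : ∫ t : T_∞, χ(t) · archWitnessOf (t⁻¹ γ₀) ∂ν_∞ ≠ 0`
(the `T_∞`-Fourier coefficient of the branch witness at the line's `γ₀`).  This module reads the integral as a function
`γ ↦ ∫_{T_∞} χ(t) · archWitnessOf (t⁻¹ γ)` on `G(𝔸)` and proves, with NO definition (kernel lane):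

* **`integral_chi_archWitnessOf_torusInf_mul`** — the LEFT `T_∞`-law: the integral at `s γ` (`s ∈ T_∞`) is `χ(s)` times the
  integral at `γ` (left invariance of the Haar measure, `integral_mul_left_eq_self`; no integrability hypothesis);
* **`integral_chi_archWitnessOf_mul_torus'`** — the RIGHT `T′(𝔸)`-law: at `γ κ` (`κ ∈ T′(𝔸)`) it is `Wt(κ)` times the
  integral at `γ` (part 1's right law, pointwise under the integral).  So `hF` is a statement about the double coset
  `T_∞ γ₀ T′(𝔸)`;
* **`exists_archWitnessOf_ne_zero_of_integral_ne_zero`** — `hF(γ₀)` forces the witness to be non-zero somewhere on `T_∞ γ₀`;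
* **THE IDENTITY-INSTANCE REDUCTION** — under `torusT W ≤ torusT' W` (the instance C-L4-PLANE-INSTANCE S16257 (3) inhabits:
  `g = 1`, `lam = 1`, `a 1 = a 0`, `a 3 = a 2`, so `T′ = T`), `integral_chi_archWitnessOf_eq_of_torusT_le`:
  `∫_{T_∞} χ(t) · archWitnessOf (t⁻¹ γ) = (∫_{T_∞} χ(t) · Wt(t⁻¹)) · archWitnessOf γ`, and with character orthogonality on
  the compact `T_∞` (`integral_ne_zero_iff_of_mul`: `∫ ψ ≠ 0 ↔ ψ ≡ 1` for a multiplicative `ψ` and the Haar PROBABILITY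
  measure; `chi_mul_torusWeight'_inv_mul` makes `t ↦ χ(t) · Wt(t⁻¹)` multiplicative)
  **`integral_chi_archWitnessOf_ne_zero_iff_of_torusT_le`**:
  `hF(γ) ⟺ (∀ t ∈ T_∞, χ(t) · Wt(t⁻¹) = 1) ∧ archWitnessOf γ ≠ 0`;
* **at `g = g′ = 1`** `torusT' = torusT` outright (`torusT'_withTransportedTorus_one`: `Q i = 1 · P i · 1`), so the reduction
  holds with no `hle` binder: `integral_chi_archWitnessOf_ne_zero_iff_of_one`.

READING.  In the instance the bridge inhabits, the archimedean conjunct of the `γ₀`-existence display is NOT a condition on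
`γ₀` alone: it is (a) a K-TYPE IDENTITY `χ_∞ = Wt` between the character of `R` and the witness's weight character on `T_∞`
(a relation between the displayed integers `(eP, eM)` and `(eP′, eM′)` at EVERY infinite place through `ChiMatchesAt`; no
choice of `γ₀` can repair it if it fails) and (b) the Zariski-open condition of part 1's pointwise criterion on the diagonal
entries of the `T′`-adapted definite blocks of `γ₀` — met by any rational `γ₀` whose definite blocks have non-zero
diagonal (e.g. near `1`).  Nothing here says anything about the status of the Hodge conjecture for CM abelian varieties,
which is NOT proved (HC_CM is NOT proved by anyone in this repository).
-/

set_option autoImplicit false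

noncomputable section

namespace Summit.Ventures.HodgeRepro.Tier4.Line4

open Summit.Ventures.HodgeRepro.Tier4.Common Summit.Ventures.HodgeRepro.Tier4.Line1 NumberField Matrix MeasureTheory

open scoped ComplexConjugate

open scoped Classical

section Generic

/-- **character orthogonality on a compact group, the `iff` form**: for a multiplicative `ψ` and a left-invariant
probability measure, `∫ ψ ≠ 0 ↔ ψ ≡ 1` (`integral_eq_zero_of_mul_left_eq_smul` for the vanishing direction;
`∫ 1 = 1` for the other). -/
theorem integral_ne_zero_iff_of_mul {T : Type*} [Group T] [MeasurableSpace T] [MeasurableMul T]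
    (ν : Measure T) [ν.IsMulLeftInvariant] [IsProbabilityMeasure ν] (ψ : T → ℂ)
    (hψ : ∀ s t, ψ (s * t) = ψ s * ψ t) :
    (∫ t, ψ t ∂ν) ≠ 0 ↔ ∀ t, ψ t = 1 := by
  constructor
  · intro hne t
    by_contra ht
    exact hne (integral_eq_zero_of_mul_left_eq_smul ν ψ t (ψ t) ht fun u => hψ t u)
  · intro h1
    simp only [h1, integral_const, probReal_univ, one_smul]
    exact one_ne_zero

end Generic

section Fourier

variable {k : Type} [Field k] [NumberField k] (q : QuadData k) (a : Fin 4 → k)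
  (g g' : Matrix (Fin 4) (Fin 4) k) (hgg' : g * g' = 1) (hg'g : g' * g = 1)
  (hgΩ : g * (PlaneData.mixedRow q (a 0) (a 2)).Ω = (PlaneData.mixedRow q (a 0) (a 2)).Ω * g)
  (lam : k) (hlam : lam ≠ 0)
  (hiso : g * (PlaneData.mixedRow q (a 1) (a 3)).B * gᵀ = lam • (PlaneData.mixedRow q (a 0) (a 2)).B)
  (w₀ : InfinitePlace k) (eP' eM' : InfinitePlace k → ℤ)
  [MeasurableSpace (GA ((PlaneData.mixedRow q (a 0) (a 2)).withTransportedTorus g g' hgg' hg'g hgΩ))]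
  [BorelSpace (GA ((PlaneData.mixedRow q (a 0) (a 2)).withTransportedTorus g g' hgg' hg'g hgΩ))]
  (R : RTFData ((PlaneData.mixedRow q (a 0) (a 2)).withTransportedTorus g g' hgg' hg'g hgΩ))
  (νinf : Measure (torusInf ((PlaneData.mixedRow q (a 0) (a 2)).withTransportedTorus g g' hgg' hg'g hgΩ)))

omit [BorelSpace (GA ((PlaneData.mixedRow q (a 0) (a 2)).withTransportedTorus g g' hgg' hg'g hgΩ))] in
/-- **`hF(γ₀)` forces the witness to be non-zero somewhere on `T_∞ γ₀`**: a non-zero integral has a non-zero integrand. -/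
theorem exists_archWitnessOf_ne_zero_of_integral_ne_zero (γ : GA ((PlaneData.mixedRow q (a 0) (a 2)).withTransportedTorus g g' hgg' hg'g hgΩ))
    (hF : (∫ t : torusInf ((PlaneData.mixedRow q (a 0) (a 2)).withTransportedTorus g g' hgg' hg'g hgΩ),
        R.chi t * archWitnessOf q a g g' hgg' hg'g hgΩ lam hiso w₀ eP' eM' ((((t : torusT ((PlaneData.mixedRow q (a 0) (a 2)).withTransportedTorus g g' hgg' hg'g hgΩ)) : GA ((PlaneData.mixedRow q (a 0) (a 2)).withTransportedTorus g g' hgg' hg'g hgΩ)))⁻¹ * γ) ∂νinf) ≠ 0) :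
    ∃ t : torusInf ((PlaneData.mixedRow q (a 0) (a 2)).withTransportedTorus g g' hgg' hg'g hgΩ), archWitnessOf q a g g' hgg' hg'g hgΩ lam hiso w₀ eP' eM' ((((t : torusT ((PlaneData.mixedRow q (a 0) (a 2)).withTransportedTorus g g' hgg' hg'g hgΩ)) : GA ((PlaneData.mixedRow q (a 0) (a 2)).withTransportedTorus g g' hgg' hg'g hgΩ)))⁻¹ * γ) ≠ 0 := by
  by_contra hall
  apply hF
  have h0 : ∀ t : torusInf ((PlaneData.mixedRow q (a 0) (a 2)).withTransportedTorus g g' hgg' hg'g hgΩ),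
      R.chi t * archWitnessOf q a g g' hgg' hg'g hgΩ lam hiso w₀ eP' eM' ((((t : torusT ((PlaneData.mixedRow q (a 0) (a 2)).withTransportedTorus g g' hgg' hg'g hgΩ)) : GA ((PlaneData.mixedRow q (a 0) (a 2)).withTransportedTorus g g' hgg' hg'g hgΩ)))⁻¹ * γ) = 0 := by
    intro t
    have ht : archWitnessOf q a g g' hgg' hg'g hgΩ lam hiso w₀ eP' eM' ((((t : torusT ((PlaneData.mixedRow q (a 0) (a 2)).withTransportedTorus g g' hgg' hg'g hgΩ)) : GA ((PlaneData.mixedRow q (a 0) (a 2)).withTransportedTorus g g' hgg' hg'g hgΩ)))⁻¹ * γ) = 0 := by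
      by_contra hne
      exact hall ⟨t, hne⟩
    rw [ht, mul_zero]
  simp only [h0]
  exact integral_zero _ _

/-- **THE LEFT `T_∞`-LAW OF THE `hF` INTEGRAL**: for `s ∈ T_∞`,
`∫_{T_∞} χ(t) · archWitnessOf (t⁻¹ s γ) = χ(s) · ∫_{T_∞} χ(t) · archWitnessOf (t⁻¹ γ)` (the substitution `t = s u` under the
left-invariant measure; `χ` multiplicative; no integrability needed). -/
theorem integral_chi_archWitnessOf_torusInf_mul [Measure.IsMulLeftInvariant νinf] (s : torusInf ((PlaneData.mixedRow q (a 0) (a 2)).withTransportedTorus g g' hgg' hg'g hgΩ)) (γ : GA ((PlaneData.mixedRow q (a 0) (a 2)).withTransportedTorus g g' hgg' hg'g hgΩ)) :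
    (∫ t : torusInf ((PlaneData.mixedRow q (a 0) (a 2)).withTransportedTorus g g' hgg' hg'g hgΩ),
        R.chi t * archWitnessOf q a g g' hgg' hg'g hgΩ lam hiso w₀ eP' eM' ((((t : torusT ((PlaneData.mixedRow q (a 0) (a 2)).withTransportedTorus g g' hgg' hg'g hgΩ)) : GA ((PlaneData.mixedRow q (a 0) (a 2)).withTransportedTorus g g' hgg' hg'g hgΩ)))⁻¹ * (((s : torusT ((PlaneData.mixedRow q (a 0) (a 2)).withTransportedTorus g g' hgg' hg'g hgΩ)) : GA ((PlaneData.mixedRow q (a 0) (a 2)).withTransportedTorus g g' hgg' hg'g hgΩ)) * γ)) ∂νinf) =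
      R.chi s * (∫ t : torusInf ((PlaneData.mixedRow q (a 0) (a 2)).withTransportedTorus g g' hgg' hg'g hgΩ),
        R.chi t * archWitnessOf q a g g' hgg' hg'g hgΩ lam hiso w₀ eP' eM' ((((t : torusT ((PlaneData.mixedRow q (a 0) (a 2)).withTransportedTorus g g' hgg' hg'g hgΩ)) : GA ((PlaneData.mixedRow q (a 0) (a 2)).withTransportedTorus g g' hgg' hg'g hgΩ)))⁻¹ * γ) ∂νinf) := by
  haveI := measurableMul_torusInf ((PlaneData.mixedRow q (a 0) (a 2)).withTransportedTorus g g' hgg' hg'g hgΩ)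
  rw [← integral_const_mul]
  refine (integral_mul_left_eq_self (μ := νinf)
    (fun t : torusInf ((PlaneData.mixedRow q (a 0) (a 2)).withTransportedTorus g g' hgg' hg'g hgΩ) =>
      R.chi t * archWitnessOf q a g g' hgg' hg'g hgΩ lam hiso w₀ eP' eM' ((((t : torusT ((PlaneData.mixedRow q (a 0) (a 2)).withTransportedTorus g g' hgg' hg'g hgΩ)) : GA ((PlaneData.mixedRow q (a 0) (a 2)).withTransportedTorus g g' hgg' hg'g hgΩ)))⁻¹ * (((s : torusT ((PlaneData.mixedRow q (a 0) (a 2)).withTransportedTorus g g' hgg' hg'g hgΩ)) : GA ((PlaneData.mixedRow q (a 0) (a 2)).withTransportedTorus g g' hgg' hg'g hgΩ)) * γ))) s).symm.trans ?_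
  refine integral_congr_ae (Filter.Eventually.of_forall fun t => ?_)
  show R.chi ((s * t : torusInf ((PlaneData.mixedRow q (a 0) (a 2)).withTransportedTorus g g' hgg' hg'g hgΩ)) : torusT ((PlaneData.mixedRow q (a 0) (a 2)).withTransportedTorus g g' hgg' hg'g hgΩ)) *
      archWitnessOf q a g g' hgg' hg'g hgΩ lam hiso w₀ eP' eM' (((((s * t : torusInf ((PlaneData.mixedRow q (a 0) (a 2)).withTransportedTorus g g' hgg' hg'g hgΩ)) : torusT ((PlaneData.mixedRow q (a 0) (a 2)).withTransportedTorus g g' hgg' hg'g hgΩ)) : GA ((PlaneData.mixedRow q (a 0) (a 2)).withTransportedTorus g g' hgg' hg'g hgΩ)))⁻¹ * (((s : torusT ((PlaneData.mixedRow q (a 0) (a 2)).withTransportedTorus g g' hgg' hg'g hgΩ)) : GA ((PlaneData.mixedRow q (a 0) (a 2)).withTransportedTorus g g' hgg' hg'g hgΩ)) * γ)) = _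
  rw [Subgroup.coe_mul, R.chi_mul, Subgroup.coe_mul]
  have harg : (((s : torusT ((PlaneData.mixedRow q (a 0) (a 2)).withTransportedTorus g g' hgg' hg'g hgΩ)) : GA ((PlaneData.mixedRow q (a 0) (a 2)).withTransportedTorus g g' hgg' hg'g hgΩ)) * ((t : torusT ((PlaneData.mixedRow q (a 0) (a 2)).withTransportedTorus g g' hgg' hg'g hgΩ)) : GA ((PlaneData.mixedRow q (a 0) (a 2)).withTransportedTorus g g' hgg' hg'g hgΩ)))⁻¹ * (((s : torusT ((PlaneData.mixedRow q (a 0) (a 2)).withTransportedTorus g g' hgg' hg'g hgΩ)) : GA ((PlaneData.mixedRow q (a 0) (a 2)).withTransportedTorus g g' hgg' hg'g hgΩ)) * γ) = (((t : torusT ((PlaneData.mixedRow q (a 0) (a 2)).withTransportedTorus g g' hgg' hg'g hgΩ)) : GA ((PlaneData.mixedRow q (a 0) (a 2)).withTransportedTorus g g' hgg' hg'g hgΩ)))⁻¹ * γ := by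
    rw [_root_.mul_inv_rev, mul_assoc, inv_mul_cancel_left]
  rw [harg]
  ring

omit [BorelSpace (GA ((PlaneData.mixedRow q (a 0) (a 2)).withTransportedTorus g g' hgg' hg'g hgΩ))] in
include hlam in
/-- **THE RIGHT `T′(𝔸)`-LAW OF THE `hF` INTEGRAL**: for `κ ∈ T′(𝔸)`,
`∫_{T_∞} χ(t) · archWitnessOf (t⁻¹ γ κ) = Wt(κ) · ∫_{T_∞} χ(t) · archWitnessOf (t⁻¹ γ)` (the witness's right law
pointwise under the integral; with the left law, `hF` is a statement about the double coset `T_∞ γ₀ T′(𝔸)`). -/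
theorem integral_chi_archWitnessOf_mul_torus' (hw₀ : w₀.IsReal) (hcm₀ : IsCMAt q w₀) (ha1 : a 1 ≠ 0) (ha3 : a 3 ≠ 0)
    (hdef : ∀ w' : InfinitePlace k, w' ≠ w₀ → w'.IsReal ∧ IsCMAt q w')
    (he : eP' w₀ = eM' w₀ + 3 ∨ eM' w₀ = eP' w₀ + 3) (γ κ : GA ((PlaneData.mixedRow q (a 0) (a 2)).withTransportedTorus g g' hgg' hg'g hgΩ)) (hκ : κ ∈ torusT' ((PlaneData.mixedRow q (a 0) (a 2)).withTransportedTorus g g' hgg' hg'g hgΩ)) :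
    (∫ t : torusInf ((PlaneData.mixedRow q (a 0) (a 2)).withTransportedTorus g g' hgg' hg'g hgΩ),
        R.chi t * archWitnessOf q a g g' hgg' hg'g hgΩ lam hiso w₀ eP' eM' ((((t : torusT ((PlaneData.mixedRow q (a 0) (a 2)).withTransportedTorus g g' hgg' hg'g hgΩ)) : GA ((PlaneData.mixedRow q (a 0) (a 2)).withTransportedTorus g g' hgg' hg'g hgΩ)))⁻¹ * (γ * κ)) ∂νinf) =
      torusWeight' q a g g' hgg' hg'g hgΩ eP' eM' κ * (∫ t : torusInf ((PlaneData.mixedRow q (a 0) (a 2)).withTransportedTorus g g' hgg' hg'g hgΩ),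
        R.chi t * archWitnessOf q a g g' hgg' hg'g hgΩ lam hiso w₀ eP' eM' ((((t : torusT ((PlaneData.mixedRow q (a 0) (a 2)).withTransportedTorus g g' hgg' hg'g hgΩ)) : GA ((PlaneData.mixedRow q (a 0) (a 2)).withTransportedTorus g g' hgg' hg'g hgΩ)))⁻¹ * γ) ∂νinf) := by
  rw [← integral_const_mul]
  refine integral_congr_ae (Filter.Eventually.of_forall fun t => ?_)
  show R.chi t * archWitnessOf q a g g' hgg' hg'g hgΩ lam hiso w₀ eP' eM' _ = _
  rw [← mul_assoc _ γ κ, archWitnessOf_mul_torus' q a g g' hgg' hg'g hgΩ lam hlam hiso w₀ eP' eM' hw₀ hcm₀ ha1 ha3 hdef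
    he _ κ hκ]
  ring

omit [BorelSpace (GA ((PlaneData.mixedRow q (a 0) (a 2)).withTransportedTorus g g' hgg' hg'g hgΩ))] in
include hlam in
/-- **THE IDENTITY-INSTANCE REDUCTION (the integral)**: when `T ≤ T′` (the instance `g = 1`, `lam = 1`, `a 1 = a 0`,
`a 3 = a 2` of C-L4-PLANE-INSTANCE, where `T′ = T`), every `t ∈ T_∞` acts on the witness by the LEFT `T′`-law, so
`∫_{T_∞} χ(t) · archWitnessOf (t⁻¹ γ) = (∫_{T_∞} χ(t) · Wt(t⁻¹)) · archWitnessOf γ`. -/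
theorem integral_chi_archWitnessOf_eq_of_torusT_le (hw₀ : w₀.IsReal) (hcm₀ : IsCMAt q w₀) (ha1 : a 1 ≠ 0)
    (ha3 : a 3 ≠ 0) (hdef : ∀ w' : InfinitePlace k, w' ≠ w₀ → w'.IsReal ∧ IsCMAt q w')
    (he : eP' w₀ = eM' w₀ + 3 ∨ eM' w₀ = eP' w₀ + 3)
    (hle : torusT ((PlaneData.mixedRow q (a 0) (a 2)).withTransportedTorus g g' hgg' hg'g hgΩ) ≤ torusT' ((PlaneData.mixedRow q (a 0) (a 2)).withTransportedTorus g g' hgg' hg'g hgΩ)) (γ : GA ((PlaneData.mixedRow q (a 0) (a 2)).withTransportedTorus g g' hgg' hg'g hgΩ)) :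
    (∫ t : torusInf ((PlaneData.mixedRow q (a 0) (a 2)).withTransportedTorus g g' hgg' hg'g hgΩ),
        R.chi t * archWitnessOf q a g g' hgg' hg'g hgΩ lam hiso w₀ eP' eM' ((((t : torusT ((PlaneData.mixedRow q (a 0) (a 2)).withTransportedTorus g g' hgg' hg'g hgΩ)) : GA ((PlaneData.mixedRow q (a 0) (a 2)).withTransportedTorus g g' hgg' hg'g hgΩ)))⁻¹ * γ) ∂νinf) =
      (∫ t : torusInf ((PlaneData.mixedRow q (a 0) (a 2)).withTransportedTorus g g' hgg' hg'g hgΩ),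
        R.chi t * torusWeight' q a g g' hgg' hg'g hgΩ eP' eM' ((((t : torusT ((PlaneData.mixedRow q (a 0) (a 2)).withTransportedTorus g g' hgg' hg'g hgΩ)) : GA ((PlaneData.mixedRow q (a 0) (a 2)).withTransportedTorus g g' hgg' hg'g hgΩ)))⁻¹) ∂νinf) * archWitnessOf q a g g' hgg' hg'g hgΩ lam hiso w₀ eP' eM' γ := by
  rw [← integral_mul_const]
  refine integral_congr_ae (Filter.Eventually.of_forall fun t => ?_)
  show R.chi t * archWitnessOf q a g g' hgg' hg'g hgΩ lam hiso w₀ eP' eM' ((((t : torusT ((PlaneData.mixedRow q (a 0) (a 2)).withTransportedTorus g g' hgg' hg'g hgΩ)) : GA ((PlaneData.mixedRow q (a 0) (a 2)).withTransportedTorus g g' hgg' hg'g hgΩ)))⁻¹ * γ) =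
    R.chi t * torusWeight' q a g g' hgg' hg'g hgΩ eP' eM' ((((t : torusT ((PlaneData.mixedRow q (a 0) (a 2)).withTransportedTorus g g' hgg' hg'g hgΩ)) : GA ((PlaneData.mixedRow q (a 0) (a 2)).withTransportedTorus g g' hgg' hg'g hgΩ)))⁻¹) * archWitnessOf q a g g' hgg' hg'g hgΩ lam hiso w₀ eP' eM' γ
  have hmem : (((t : torusT ((PlaneData.mixedRow q (a 0) (a 2)).withTransportedTorus g g' hgg' hg'g hgΩ)) : GA ((PlaneData.mixedRow q (a 0) (a 2)).withTransportedTorus g g' hgg' hg'g hgΩ)))⁻¹ ∈ torusT' ((PlaneData.mixedRow q (a 0) (a 2)).withTransportedTorus g g' hgg' hg'g hgΩ) :=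
    (torusT' ((PlaneData.mixedRow q (a 0) (a 2)).withTransportedTorus g g' hgg' hg'g hgΩ)).inv_mem (hle (t : torusT ((PlaneData.mixedRow q (a 0) (a 2)).withTransportedTorus g g' hgg' hg'g hgΩ)).2)
  rw [archWitnessOf_torus'_mul q a g g' hgg' hg'g hgΩ lam hlam hiso w₀ eP' eM' hw₀ hcm₀ ha1 ha3 hdef he γ _ hmem,
    mul_assoc]

omit [BorelSpace (GA ((PlaneData.mixedRow q (a 0) (a 2)).withTransportedTorus g g' hgg' hg'g hgΩ))] in
include lam hlam hiso in
/-- **the character `t ↦ χ(t) · Wt(t⁻¹)` is multiplicative on `T_∞`** when `T ≤ T′` (`chi_mul`, `torusWeight'_mul`). -/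
theorem chi_mul_torusWeight'_inv_mul (hall : ∀ w : InfinitePlace k, w.IsReal ∧ IsCMAt q w) (ha1 : a 1 ≠ 0)
    (ha3 : a 3 ≠ 0) (hle : torusT ((PlaneData.mixedRow q (a 0) (a 2)).withTransportedTorus g g' hgg' hg'g hgΩ) ≤ torusT' ((PlaneData.mixedRow q (a 0) (a 2)).withTransportedTorus g g' hgg' hg'g hgΩ)) (s t : torusInf ((PlaneData.mixedRow q (a 0) (a 2)).withTransportedTorus g g' hgg' hg'g hgΩ)) :
    R.chi (s * t) * torusWeight' q a g g' hgg' hg'g hgΩ eP' eM' (((((s * t : torusInf ((PlaneData.mixedRow q (a 0) (a 2)).withTransportedTorus g g' hgg' hg'g hgΩ)) : torusT ((PlaneData.mixedRow q (a 0) (a 2)).withTransportedTorus g g' hgg' hg'g hgΩ)) : GA ((PlaneData.mixedRow q (a 0) (a 2)).withTransportedTorus g g' hgg' hg'g hgΩ)))⁻¹) =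
      (R.chi s * torusWeight' q a g g' hgg' hg'g hgΩ eP' eM' ((((s : torusT ((PlaneData.mixedRow q (a 0) (a 2)).withTransportedTorus g g' hgg' hg'g hgΩ)) : GA ((PlaneData.mixedRow q (a 0) (a 2)).withTransportedTorus g g' hgg' hg'g hgΩ)))⁻¹)) * (R.chi t * torusWeight' q a g g' hgg' hg'g hgΩ eP' eM' ((((t : torusT ((PlaneData.mixedRow q (a 0) (a 2)).withTransportedTorus g g' hgg' hg'g hgΩ)) : GA ((PlaneData.mixedRow q (a 0) (a 2)).withTransportedTorus g g' hgg' hg'g hgΩ)))⁻¹)) := by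
  have hs : (((s : torusT ((PlaneData.mixedRow q (a 0) (a 2)).withTransportedTorus g g' hgg' hg'g hgΩ)) : GA ((PlaneData.mixedRow q (a 0) (a 2)).withTransportedTorus g g' hgg' hg'g hgΩ)))⁻¹ ∈ torusT' ((PlaneData.mixedRow q (a 0) (a 2)).withTransportedTorus g g' hgg' hg'g hgΩ) :=
    (torusT' ((PlaneData.mixedRow q (a 0) (a 2)).withTransportedTorus g g' hgg' hg'g hgΩ)).inv_mem (hle (s : torusT ((PlaneData.mixedRow q (a 0) (a 2)).withTransportedTorus g g' hgg' hg'g hgΩ)).2)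
  have ht : (((t : torusT ((PlaneData.mixedRow q (a 0) (a 2)).withTransportedTorus g g' hgg' hg'g hgΩ)) : GA ((PlaneData.mixedRow q (a 0) (a 2)).withTransportedTorus g g' hgg' hg'g hgΩ)))⁻¹ ∈ torusT' ((PlaneData.mixedRow q (a 0) (a 2)).withTransportedTorus g g' hgg' hg'g hgΩ) :=
    (torusT' ((PlaneData.mixedRow q (a 0) (a 2)).withTransportedTorus g g' hgg' hg'g hgΩ)).inv_mem (hle (t : torusT ((PlaneData.mixedRow q (a 0) (a 2)).withTransportedTorus g g' hgg' hg'g hgΩ)).2)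
  rw [Subgroup.coe_mul, R.chi_mul, Subgroup.coe_mul, _root_.mul_inv_rev,
    torusWeight'_mul q a g g' hgg' hg'g hgΩ lam hlam hiso hall ha1 ha3 eP' eM' ht hs]
  ring

include hlam in
/-- **THE IDENTITY-INSTANCE REDUCTION (the `iff`)**: when `T ≤ T′`, for the Haar probability measure on `T_∞`,
`hF(γ) ⟺ (∀ t ∈ T_∞, χ(t) · Wt(t⁻¹) = 1) ∧ archWitnessOf γ ≠ 0` — a K-TYPE IDENTITY between `χ` and the witness's weight
character on `T_∞` (no `γ` can repair it) and the POINTWISE non-vanishing of the witness at `γ` (`archWitnessOf_ne_zero_iff`). -/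
theorem integral_chi_archWitnessOf_ne_zero_iff_of_torusT_le [Measure.IsMulLeftInvariant νinf]
    [IsProbabilityMeasure νinf]
    (hall : ∀ w : InfinitePlace k, w.IsReal ∧ IsCMAt q w) (ha1 : a 1 ≠ 0) (ha3 : a 3 ≠ 0)
    (he : eP' w₀ = eM' w₀ + 3 ∨ eM' w₀ = eP' w₀ + 3)
    (hle : torusT ((PlaneData.mixedRow q (a 0) (a 2)).withTransportedTorus g g' hgg' hg'g hgΩ) ≤ torusT' ((PlaneData.mixedRow q (a 0) (a 2)).withTransportedTorus g g' hgg' hg'g hgΩ)) (γ : GA ((PlaneData.mixedRow q (a 0) (a 2)).withTransportedTorus g g' hgg' hg'g hgΩ)) :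
    (∫ t : torusInf ((PlaneData.mixedRow q (a 0) (a 2)).withTransportedTorus g g' hgg' hg'g hgΩ),
        R.chi t * archWitnessOf q a g g' hgg' hg'g hgΩ lam hiso w₀ eP' eM' ((((t : torusT ((PlaneData.mixedRow q (a 0) (a 2)).withTransportedTorus g g' hgg' hg'g hgΩ)) : GA ((PlaneData.mixedRow q (a 0) (a 2)).withTransportedTorus g g' hgg' hg'g hgΩ)))⁻¹ * γ) ∂νinf) ≠ 0 ↔
      (∀ t : torusInf ((PlaneData.mixedRow q (a 0) (a 2)).withTransportedTorus g g' hgg' hg'g hgΩ), R.chi t * torusWeight' q a g g' hgg' hg'g hgΩ eP' eM' ((((t : torusT ((PlaneData.mixedRow q (a 0) (a 2)).withTransportedTorus g g' hgg' hg'g hgΩ)) : GA ((PlaneData.mixedRow q (a 0) (a 2)).withTransportedTorus g g' hgg' hg'g hgΩ)))⁻¹) = 1) ∧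
        archWitnessOf q a g g' hgg' hg'g hgΩ lam hiso w₀ eP' eM' γ ≠ 0 := by
  haveI := measurableMul_torusInf ((PlaneData.mixedRow q (a 0) (a 2)).withTransportedTorus g g' hgg' hg'g hgΩ)
  rw [integral_chi_archWitnessOf_eq_of_torusT_le q a g g' hgg' hg'g hgΩ lam hlam hiso w₀ eP' eM' R νinf (hall w₀).1
    (hall w₀).2 ha1 ha3 (fun w' _ => hall w') he hle γ, mul_ne_zero_iff,
    integral_ne_zero_iff_of_mul νinf _ (chi_mul_torusWeight'_inv_mul q a g g' hgg' hg'g hgΩ lam hlam hiso eP' eM' R hall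
      ha1 ha3 hle)]

end Fourier

section Identity

variable {k : Type} [Field k] [NumberField k] (q : QuadData k) (a : Fin 4 → k)
  (hgg' : (1 : Matrix (Fin 4) (Fin 4) k) * 1 = 1) (hg'g : (1 : Matrix (Fin 4) (Fin 4) k) * 1 = 1)
  (hgΩ : (1 : Matrix (Fin 4) (Fin 4) k) * (PlaneData.mixedRow q (a 0) (a 2)).Ω = (PlaneData.mixedRow q (a 0) (a 2)).Ω * 1)

/-- **at `g = g′ = 1` the transported torus IS the torus**: `Q i = 1 · P i · 1 = P i`, so `torusT' = torusT` (the data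
C-L4-PLANE-INSTANCE S16257 (3) inhabits; note that `a 1`, `a 3`, `lam`, `hiso` play no role — `T′` is transported from the
FIRST plane's projectors). -/
theorem torusT'_withTransportedTorus_one :
    torusT' ((PlaneData.mixedRow q (a 0) (a 2)).withTransportedTorus 1 1 hgg' hg'g hgΩ) = torusT ((PlaneData.mixedRow q (a 0) (a 2)).withTransportedTorus 1 1 hgg' hg'g hgΩ) := by
  simp only [torusT', torusT, PlaneData.withTransportedTorus, Matrix.one_mul, Matrix.mul_one]

/-- **THE IDENTITY-INSTANCE REDUCTION AT `g = g′ = 1`** (no `hle` binder: `torusT' = torusT` by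
`torusT'_withTransportedTorus_one`): for the Haar probability measure on `T_∞`,
`hF(γ) ⟺ (∀ t ∈ T_∞, χ(t) · Wt(t⁻¹) = 1) ∧ archWitnessOf γ ≠ 0`. -/
theorem integral_chi_archWitnessOf_ne_zero_iff_of_one [MeasurableSpace (GA ((PlaneData.mixedRow q (a 0) (a 2)).withTransportedTorus 1 1 hgg' hg'g hgΩ))] [BorelSpace (GA ((PlaneData.mixedRow q (a 0) (a 2)).withTransportedTorus 1 1 hgg' hg'g hgΩ))]
    (lam : k) (hlam : lam ≠ 0)
    (hiso : (1 : Matrix (Fin 4) (Fin 4) k) * (PlaneData.mixedRow q (a 1) (a 3)).B * (1 : Matrix (Fin 4) (Fin 4) k)ᵀ =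
      lam • (PlaneData.mixedRow q (a 0) (a 2)).B)
    (w₀ : InfinitePlace k) (eP' eM' : InfinitePlace k → ℤ) (R : RTFData ((PlaneData.mixedRow q (a 0) (a 2)).withTransportedTorus 1 1 hgg' hg'g hgΩ))
    (νinf : Measure (torusInf ((PlaneData.mixedRow q (a 0) (a 2)).withTransportedTorus 1 1 hgg' hg'g hgΩ))) [Measure.IsMulLeftInvariant νinf] [IsProbabilityMeasure νinf]
    (hall : ∀ w : InfinitePlace k, w.IsReal ∧ IsCMAt q w) (ha1 : a 1 ≠ 0) (ha3 : a 3 ≠ 0)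
    (he : eP' w₀ = eM' w₀ + 3 ∨ eM' w₀ = eP' w₀ + 3) (γ : GA ((PlaneData.mixedRow q (a 0) (a 2)).withTransportedTorus 1 1 hgg' hg'g hgΩ)) :
    (∫ t : torusInf ((PlaneData.mixedRow q (a 0) (a 2)).withTransportedTorus 1 1 hgg' hg'g hgΩ),
        R.chi t * archWitnessOf q a 1 1 hgg' hg'g hgΩ lam hiso w₀ eP' eM' ((((t : torusT ((PlaneData.mixedRow q (a 0) (a 2)).withTransportedTorus 1 1 hgg' hg'g hgΩ)) : GA ((PlaneData.mixedRow q (a 0) (a 2)).withTransportedTorus 1 1 hgg' hg'g hgΩ)))⁻¹ * γ) ∂νinf) ≠ 0 ↔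
      (∀ t : torusInf ((PlaneData.mixedRow q (a 0) (a 2)).withTransportedTorus 1 1 hgg' hg'g hgΩ), R.chi t * torusWeight' q a 1 1 hgg' hg'g hgΩ eP' eM' ((((t : torusT ((PlaneData.mixedRow q (a 0) (a 2)).withTransportedTorus 1 1 hgg' hg'g hgΩ)) : GA ((PlaneData.mixedRow q (a 0) (a 2)).withTransportedTorus 1 1 hgg' hg'g hgΩ)))⁻¹) = 1) ∧
        archWitnessOf q a 1 1 hgg' hg'g hgΩ lam hiso w₀ eP' eM' γ ≠ 0 :=
  integral_chi_archWitnessOf_ne_zero_iff_of_torusT_le q a 1 1 hgg' hg'g hgΩ lam hlam hiso w₀ eP' eM' R νinf hall ha1 ha3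
    he (le_of_eq (torusT'_withTransportedTorus_one q a hgg' hg'g hgΩ).symm) γ

end Identity

end Summit.Ventures.HodgeRepro.Tier4.Line4
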